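import Literature.RepresentationTheory.Kovacevic2021.SU21SubmoduleLattice
import Literature.RepresentationTheory.Kovacevic2021.SU21ArrowReversal
import Literature.RepresentationTheory.Kovacevic2021.SU21Casimir
import HarnessLib

/-!
# Subquotient data: the `K`-type datum of `N₂ ⧸ (N₁ ⊓ N₂)` for two Lie submodules of a Kovačević datum

Continuation of `…Kovacevic2021.SU21SubmoduleLattice` (a Lie submodule `N` of the `𝔤𝔩(3,ℂ)`-module
`𝒟.V` of a datum `𝒟 : SU21Datum` is the space of functions supported on the `K`-types it meets, and the set
of these `K`-types is closed under the LIVE arrows) [Kovacevic2021, §3 Thm 1, Thm 2, Remarks 2, 3, 6].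

Source, verbatim [Kovacevic2021, §3 Remark 6, held text `paper:arxiv-1810.01752` p0008]: "Reducibility of
modules `V(c,2t)` will be obtained when some product(s) `a_{nm} d_{n+1,m+3}` or `b_{nm} c_{n+1,m-3}` are equal
to `0`. … it will be possible to determine if we have a submodule, quotient or subquotient."  This file makes
"subquotient" precise at the level of data: **the subquotient of a `K`-type datum is again a `K`-type datum**,
with the obvious `K`-types and the SAME arrow coefficients between them.

## What is here

For a datum `𝒟` and two Lie submodules `N₁, N₂ ⊆ 𝒟.V` (no inclusion assumed):
* DEFINITIONS (with bodies): `sqSet` — the `K`-types met by `N₂` and not by `N₁`; `sqCoef` — the arrow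
  coefficients of `𝒟` restricted to the arrows INSIDE `sqSet`; **`subquotient 𝒟 N₁ N₂ : SU21Datum`** — the
  subquotient datum.  The relations (b20)–(b45) survive because a two-step product of arrow coefficients
  `x → y → z` with `x, z ∈ sqSet`, `y ∉ sqSet` vanishes (`coef_mul_coef_eq_zero_of_not_mem`: the `K`-types of
  `N₁` and of `N₂` are arrow-closed), so every product appearing in the relations is either unchanged
  (`sqCoef_mul_sqCoef`) or `0` on both sides.
* THEOREMS: the gauge-invariant products and the Casimir scalar of the subquotient are those of `𝒟` on `sqSet`
  (`subquotient_AD/BC/DA/CB`, `subquotient_casimirScalar`); live steps of the subquotient = live steps of `𝒟`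
  inside `sqSet` (`step_subquotient_iff`, `reach_subquotient_of_forall_step`); and, for ANY datum, the
  irreducibility criterion `isIrreducible_of_forall_reach` / `isIrreducible_iff_forall_reach` (strong
  connectivity along live arrows ⇔ irreducible, given a `K`-type; the `⇒` half restates
  `SU21CohomologicalClassification.forall_reach_of_isIrreducible` via `isIrreducible_iff_closed`).

Special cases: `N₁ = ⊥` is the SUB-datum of `N₂`, `N₂ = ⊤` the QUOTIENT datum of `𝒟.V ⧸ N₁`.  The sequel
`SU21SubquotientModule` proves that the module of `subquotient 𝒟 N₁ N₂` IS `N₂ ⧸ (N₁ ⊓ N₂)` (a surjective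
morphism of Lie modules `N₂ → (subquotient 𝒟 N₁ N₂).V` with kernel `N₁ ⊓ N₂`), and
`SU21PrincipalSeriesCompositionFactors` identifies the composition factors of the cohomological principal series
`V(0,0)`, `V(−3/2,±6)` with the six cohomological modules this way.

## References

* D. Kovačević, *Unitary `(𝔤,K)` modules of `SU(2,1)`*, Acta Math. Spalatensia 1 (2021) 105–125
  (arXiv:1810.01752): §3 Thm 1, Thm 2, Remarks 2, 3, 6. [Kovacevic2021]
* A. Borel, N. Wallach (2000), VI 4.10 (10) p. 132 (the constituents of the reducible principal series of
  `SU(2,1)`). [BorelWallach2000]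
-/

noncomputable section

open Finsupp

namespace Literature.RepresentationTheory.Kovacevic2021

-- Mathlib idiom (Mathlib/Algebra/Lie/OfAssociative.lean): commutator brackets on associative algebras; needed for
-- the `𝔤𝔩(3,ℂ)`-module structure on `𝒟.V`, as in every file of this directory.
attribute [local instance 100] LieRing.ofAssociativeRing

namespace SU21Datum

variable (𝒟 : SU21Datum) (N₁ N₂ : LieSubmodule ℂ (Matrix (Fin 3) (Fin 3) ℂ) 𝒟.V)

/-! ## §1 The `K`-types of a subquotient and the restricted arrow coefficients -/

/-- **The `K`-types of the subquotient `N₂ ⧸ (N₁ ⊓ N₂)`**: the `K`-types `(n,m)` of `𝒟` whose highest-weight vector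
`u^1_{n,m}` lies in `N₂` but not in `N₁` (a Lie submodule is the span of the FULL `K`-types it meets,
`SU21SubmoduleLattice.toSubmodule_eq_supported`). [cite: Kovacevic2021, §3 Remark 2 and Remark 6] -/
def sqSet : Set (ℤ × ℤ) := {x | x ∈ 𝒟.S ∧ 𝒟.vec x.1 x.2 1 ∈ N₂ ∧ 𝒟.vec x.1 x.2 1 ∉ N₁}

open Classical in
/-- **The arrow coefficients of the subquotient**: the coefficient of `𝒟` on an arrow with source AND target in
`sqSet`, and `0` on every other arrow. [cite: Kovacevic2021, §3 Thm 1 and Remark 6] -/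
def sqCoef (δ : Dir) (n m : ℤ) : ℂ :=
  if (n, m) ∈ 𝒟.sqSet N₁ N₂ ∧ δ.shift (n, m) ∈ 𝒟.sqSet N₁ N₂ then 𝒟.coef δ n m else 0

variable {𝒟 N₁ N₂}

/-- the `K`-types of the subquotient are `K`-types of `𝒟` [cite: Kovacevic2021, §3 Remark 6] -/
theorem mem_S_of_mem_sqSet {x : ℤ × ℤ} (h : x ∈ 𝒟.sqSet N₁ N₂) : x ∈ 𝒟.S := h.1

/-- unfolding `sqSet` [cite: Kovacevic2021, §3 Remark 6] -/
theorem mem_sqSet_iff {n m : ℤ} :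
    (n, m) ∈ 𝒟.sqSet N₁ N₂ ↔ (n, m) ∈ 𝒟.S ∧ 𝒟.vec n m 1 ∈ N₂ ∧ 𝒟.vec n m 1 ∉ N₁ := Iff.rfl

/-- on an arrow inside `sqSet` the restricted coefficient is the coefficient of `𝒟` [cite: Kovacevic2021, §3 Remark 6] -/
theorem sqCoef_of_mem {δ : Dir} {n m : ℤ} (hx : (n, m) ∈ 𝒟.sqSet N₁ N₂) (hy : δ.shift (n, m) ∈ 𝒟.sqSet N₁ N₂) :
    𝒟.sqCoef N₁ N₂ δ n m = 𝒟.coef δ n m := by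
  rw [sqCoef, if_pos ⟨hx, hy⟩]

/-- an arrow whose source is not in `sqSet` has restricted coefficient `0` [cite: Kovacevic2021, §3 Remark 6] -/
theorem sqCoef_of_not_mem_src {δ : Dir} {n m : ℤ} (hx : (n, m) ∉ 𝒟.sqSet N₁ N₂) : 𝒟.sqCoef N₁ N₂ δ n m = 0 := by
  rw [sqCoef, if_neg fun h => hx h.1]

/-- an arrow whose target is not in `sqSet` has restricted coefficient `0` [cite: Kovacevic2021, §3 Remark 6] -/
theorem sqCoef_of_not_mem_tgt {δ : Dir} {n m : ℤ} (hy : δ.shift (n, m) ∉ 𝒟.sqSet N₁ N₂) :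
    𝒟.sqCoef N₁ N₂ δ n m = 0 := by
  rw [sqCoef, if_neg fun h => hy h.2]

/-- the restricted coefficient is either the original one or `0` [cite: Kovacevic2021, §3 Remark 6] -/
theorem sqCoef_eq_or {δ : Dir} {n m : ℤ} : 𝒟.sqCoef N₁ N₂ δ n m = 𝒟.coef δ n m ∨ 𝒟.sqCoef N₁ N₂ δ n m = 0 := by
  unfold sqCoef
  split_ifs
  · exact Or.inl rfl
  · exact Or.inr rfl

/-- a non-zero restricted coefficient is the original one, on an arrow inside `sqSet` [cite: Kovacevic2021, §3 Remark 6] -/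
theorem sqCoef_ne_zero_iff {δ : Dir} {n m : ℤ} :
    𝒟.sqCoef N₁ N₂ δ n m ≠ 0 ↔ (n, m) ∈ 𝒟.sqSet N₁ N₂ ∧ δ.shift (n, m) ∈ 𝒟.sqSet N₁ N₂ ∧ 𝒟.coef δ n m ≠ 0 := by
  unfold sqCoef
  split_ifs with h
  · exact ⟨fun hc => ⟨h.1, h.2, hc⟩, fun hc => hc.2.2⟩
  · simp only [ne_eq, not_true_eq_false, false_iff, not_and, not_not]
    exact fun hx hy => absurd ⟨hx, hy⟩ h

/-- **The `K`-types of a Lie submodule are closed under the live arrows**, in the language of directions: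
`u^1_x ∈ N` and the arrow `δ` out of `x` live `⇒ u^1_{x+δ} ∈ N`. [cite: Kovacevic2021, §3 Thm 1 and Remark 2] -/
theorem vec_one_shift_mem_of_coef_ne_zero (N : LieSubmodule ℂ (Matrix (Fin 3) (Fin 3) ℂ) 𝒟.V) (δ : Dir) {n m : ℤ}
    (h1 : 𝒟.vec n m 1 ∈ N) (hc : 𝒟.coef δ n m ≠ 0) : 𝒟.vec (δ.shift (n, m)).1 (δ.shift (n, m)).2 1 ∈ N := by
  cases δ
  · exact vec_one_mem_of_A_ne_zero N h1 hc
  · exact vec_one_mem_of_B_ne_zero N h1 hc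
  · exact vec_one_mem_of_C_ne_zero N h1 hc
  · exact vec_one_mem_of_D_ne_zero N h1 hc

/-- **The principle behind the subquotient datum**: a two-step product of arrow coefficients `x → y → z` of `𝒟`
with `x, z ∈ sqSet` and `y ∉ sqSet` vanishes (if `u^1_y ∉ N₂` the first arrow is dead since the `K`-types of `N₂`
are arrow-closed; if `u^1_y ∈ N₁` the second one is, since those of `N₁` are). [cite: Kovacevic2021, §3 Remark 2, Remark 6] -/
theorem coef_mul_coef_eq_zero_of_not_mem {δ δ' : Dir} {n m n' m' n'' m'' : ℤ} (hy : δ.shift (n, m) = (n', m'))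
    (hz : δ'.shift (n', m') = (n'', m'')) (hx : (n, m) ∈ 𝒟.sqSet N₁ N₂) (hy' : (n', m') ∉ 𝒟.sqSet N₁ N₂)
    (hz' : (n'', m'') ∈ 𝒟.sqSet N₁ N₂) : 𝒟.coef δ n m * 𝒟.coef δ' n' m' = 0 := by
  by_cases hyS : (n', m') ∈ 𝒟.S
  · by_cases h2 : 𝒟.vec n' m' 1 ∈ N₂
    · -- then `u^1_y ∈ N₁`, so the second arrow is dead
      have h1 : 𝒟.vec n' m' 1 ∈ N₁ := by
        by_contra h1
        exact hy' ⟨hyS, h2, h1⟩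
      by_cases hc : 𝒟.coef δ' n' m' = 0
      · rw [hc, mul_zero]
      · have := vec_one_shift_mem_of_coef_ne_zero N₁ δ' h1 hc
        rw [hz] at this
        exact absurd this hz'.2.2
    · -- the first arrow is dead
      by_cases hc : 𝒟.coef δ n m = 0
      · rw [hc, zero_mul]
      · have := vec_one_shift_mem_of_coef_ne_zero N₂ δ hx.2.1 hc
        rw [hy] at this
        exact absurd this h2
  · rw [coef_eq_zero δ' hyS, mul_zero]

/-- **Two-step products survive in the subquotient**: for `x, z ∈ sqSet` the product of the restricted
coefficients along `x → y → z` equals the product in `𝒟`. [cite: Kovacevic2021, §3 Remark 3, Remark 6] -/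
theorem sqCoef_mul_sqCoef {δ δ' : Dir} {n m n' m' n'' m'' : ℤ} (hy : δ.shift (n, m) = (n', m'))
    (hz : δ'.shift (n', m') = (n'', m'')) (hx : (n, m) ∈ 𝒟.sqSet N₁ N₂) (hz' : (n'', m'') ∈ 𝒟.sqSet N₁ N₂) :
    𝒟.sqCoef N₁ N₂ δ n m * 𝒟.sqCoef N₁ N₂ δ' n' m' = 𝒟.coef δ n m * 𝒟.coef δ' n' m' := by
  by_cases hyT : (n', m') ∈ 𝒟.sqSet N₁ N₂
  · rw [sqCoef_of_mem hx (by rwa [hy]), sqCoef_of_mem hyT (by rwa [hz])]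
  · rw [sqCoef_of_not_mem_tgt (by rwa [hy]), zero_mul, coef_mul_coef_eq_zero_of_not_mem hy hz hx hyT hz']

/-- a two-step product whose end point is not in `sqSet` vanishes in the subquotient [cite: Kovacevic2021, §3 Remark 6] -/
theorem sqCoef_mul_sqCoef_of_not_mem {δ δ' : Dir} {n m n' m' n'' m'' : ℤ} (hy : δ.shift (n, m) = (n', m'))
    (hz : δ'.shift (n', m') = (n'', m'')) (hz' : (n'', m'') ∉ 𝒟.sqSet N₁ N₂) :
    𝒟.sqCoef N₁ N₂ δ n m * 𝒟.sqCoef N₁ N₂ δ' n' m' = 0 := by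
  have _ := hy
  rw [sqCoef_of_not_mem_tgt (δ := δ') (by rwa [hz]), mul_zero]

variable (𝒟 N₁ N₂)

/-! ## §2 The subquotient datum -/

/-- **The subquotient datum** of two Lie submodules `N₁, N₂ ⊆ 𝒟.V`: `K`-types `sqSet` (met by `N₂`, not by `N₁`),
arrow coefficients those of `𝒟` on the arrows inside `sqSet`.  The relations (b20)–(b45) of [Kovačević, Thm 2] are
inherited because every two-step product in them either stays equal (`sqCoef_mul_sqCoef`) or has both sides `0`.
Its module is `N₂ ⧸ (N₁ ⊓ N₂)` (`sqEquiv`). [cite: Kovacevic2021, §3 Thm 2, Remark 3, Remark 6] -/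
def subquotient : SU21Datum where
  S := 𝒟.sqSet N₁ N₂
  A := 𝒟.sqCoef N₁ N₂ Dir.A
  B := 𝒟.sqCoef N₁ N₂ Dir.B
  C := 𝒟.sqCoef N₁ N₂ Dir.C
  D := 𝒟.sqCoef N₁ N₂ Dir.D
  one_le_of_mem h := 𝒟.one_le_of_mem h.1
  A_eq_zero h := sqCoef_of_not_mem_src h
  B_eq_zero h := sqCoef_of_not_mem_src h
  C_eq_zero h := sqCoef_of_not_mem_src h
  D_eq_zero h := sqCoef_of_not_mem_src h
  rel20 {n m} h := by
    rw [sqCoef_mul_sqCoef (δ := Dir.A) (δ' := Dir.D) (n'' := n) (m'' := m) rfl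
        (by simp only [Dir.shift, Prod.mk.injEq]; omega) h h,
      sqCoef_mul_sqCoef (δ := Dir.B) (δ' := Dir.C) (n'' := n) (m'' := m) rfl
        (by simp only [Dir.shift, Prod.mk.injEq]; omega) h h,
      sqCoef_mul_sqCoef (δ := Dir.C) (δ' := Dir.B) (n'' := n) (m'' := m) rfl
        (by simp only [Dir.shift, Prod.mk.injEq]; omega) h h]
    exact 𝒟.rel20 h.1
  rel25 {n m} h := by
    rw [sqCoef_mul_sqCoef (δ := Dir.A) (δ' := Dir.D) (n'' := n) (m'' := m) rfl
        (by simp only [Dir.shift, Prod.mk.injEq]; omega) h h,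
      sqCoef_mul_sqCoef (δ := Dir.B) (δ' := Dir.C) (n'' := n) (m'' := m) rfl
        (by simp only [Dir.shift, Prod.mk.injEq]; omega) h h,
      sqCoef_mul_sqCoef (δ := Dir.D) (δ' := Dir.A) (n'' := n) (m'' := m) rfl
        (by simp only [Dir.shift, Prod.mk.injEq]; omega) h h]
    exact 𝒟.rel25 h.1
  rel30 n m := by
    by_cases hx : (n, m) ∈ 𝒟.sqSet N₁ N₂
    · by_cases hz : (n + 2, m) ∈ 𝒟.sqSet N₁ N₂
      · rw [sqCoef_mul_sqCoef (δ := Dir.B) (δ' := Dir.A) (n'' := n + 2) (m'' := m) rfl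
            (by simp only [Dir.shift, Prod.mk.injEq]; omega) hx hz,
          sqCoef_mul_sqCoef (δ := Dir.A) (δ' := Dir.B) (n'' := n + 2) (m'' := m) rfl
            (by simp only [Dir.shift, Prod.mk.injEq]; omega) hx hz]
        exact 𝒟.rel30 n m
      · rw [sqCoef_mul_sqCoef_of_not_mem (δ := Dir.B) (δ' := Dir.A) rfl
            (by simp only [Dir.shift, Prod.mk.injEq]; omega) hz,
          sqCoef_mul_sqCoef_of_not_mem (δ := Dir.A) (δ' := Dir.B) rfl
            (by simp only [Dir.shift, Prod.mk.injEq]; omega) hz]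
    · simp only [sqCoef_of_not_mem_src hx, zero_mul]
  rel35 n m := by
    by_cases hx : (n, m) ∈ 𝒟.sqSet N₁ N₂
    · by_cases hz : (n - 2, m) ∈ 𝒟.sqSet N₁ N₂
      · rw [sqCoef_mul_sqCoef (δ := Dir.D) (δ' := Dir.C) (n'' := n - 2) (m'' := m) rfl
            (by simp only [Dir.shift, Prod.mk.injEq]; omega) hx hz,
          sqCoef_mul_sqCoef (δ := Dir.C) (δ' := Dir.D) (n'' := n - 2) (m'' := m) rfl
            (by simp only [Dir.shift, Prod.mk.injEq]; omega) hx hz]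
        exact 𝒟.rel35 n m
      · rw [sqCoef_mul_sqCoef_of_not_mem (δ := Dir.D) (δ' := Dir.C) rfl
            (by simp only [Dir.shift, Prod.mk.injEq]; omega) hz,
          sqCoef_mul_sqCoef_of_not_mem (δ := Dir.C) (δ' := Dir.D) rfl
            (by simp only [Dir.shift, Prod.mk.injEq]; omega) hz]
    · simp only [sqCoef_of_not_mem_src hx, zero_mul]
  rel40 n m := by
    by_cases hx : (n, m) ∈ 𝒟.sqSet N₁ N₂
    · by_cases hz : (n, m + 6) ∈ 𝒟.sqSet N₁ N₂
      · rw [sqCoef_mul_sqCoef (δ := Dir.A) (δ' := Dir.C) (n'' := n) (m'' := m + 6) rfl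
            (by simp only [Dir.shift, Prod.mk.injEq]; omega) hx hz,
          sqCoef_mul_sqCoef (δ := Dir.C) (δ' := Dir.A) (n'' := n) (m'' := m + 6) rfl
            (by simp only [Dir.shift, Prod.mk.injEq]; omega) hx hz]
        exact 𝒟.rel40 n m
      · rw [sqCoef_mul_sqCoef_of_not_mem (δ := Dir.A) (δ' := Dir.C) rfl
            (by simp only [Dir.shift, Prod.mk.injEq]; omega) hz,
          sqCoef_mul_sqCoef_of_not_mem (δ := Dir.C) (δ' := Dir.A) rfl
            (by simp only [Dir.shift, Prod.mk.injEq]; omega) hz, mul_zero, mul_zero]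
    · simp only [sqCoef_of_not_mem_src hx, zero_mul, mul_zero]
  rel45 n m := by
    by_cases hx : (n, m) ∈ 𝒟.sqSet N₁ N₂
    · by_cases hz : (n, m - 6) ∈ 𝒟.sqSet N₁ N₂
      · rw [sqCoef_mul_sqCoef (δ := Dir.B) (δ' := Dir.D) (n'' := n) (m'' := m - 6) rfl
            (by simp only [Dir.shift, Prod.mk.injEq]; omega) hx hz,
          sqCoef_mul_sqCoef (δ := Dir.D) (δ' := Dir.B) (n'' := n) (m'' := m - 6) rfl
            (by simp only [Dir.shift, Prod.mk.injEq]; omega) hx hz]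
        exact 𝒟.rel45 n m
      · rw [sqCoef_mul_sqCoef_of_not_mem (δ := Dir.B) (δ' := Dir.D) rfl
            (by simp only [Dir.shift, Prod.mk.injEq]; omega) hz,
          sqCoef_mul_sqCoef_of_not_mem (δ := Dir.D) (δ' := Dir.B) rfl
            (by simp only [Dir.shift, Prod.mk.injEq]; omega) hz, mul_zero, mul_zero]
    · simp only [sqCoef_of_not_mem_src hx, zero_mul, mul_zero]

/-- the `K`-types of the subquotient datum [cite: Kovacevic2021, §3 Remark 6] -/
@[simp] theorem subquotient_S : (𝒟.subquotient N₁ N₂).S = 𝒟.sqSet N₁ N₂ := rfl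

/-- the arrow coefficients of the subquotient datum, by direction [cite: Kovacevic2021, §3 Remark 6] -/
theorem subquotient_coef (δ : Dir) (n m : ℤ) : (𝒟.subquotient N₁ N₂).coef δ n m = 𝒟.sqCoef N₁ N₂ δ n m := by
  cases δ <;> rfl

/-- the `A`-coefficients of the subquotient datum [cite: Kovacevic2021, §3 Remark 6] -/
@[simp] theorem subquotient_A : (𝒟.subquotient N₁ N₂).A = 𝒟.sqCoef N₁ N₂ Dir.A := rfl
/-- the `B`-coefficients of the subquotient datum [cite: Kovacevic2021, §3 Remark 6] -/
@[simp] theorem subquotient_B : (𝒟.subquotient N₁ N₂).B = 𝒟.sqCoef N₁ N₂ Dir.B := rfl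
/-- the `C`-coefficients of the subquotient datum [cite: Kovacevic2021, §3 Remark 6] -/
@[simp] theorem subquotient_C : (𝒟.subquotient N₁ N₂).C = 𝒟.sqCoef N₁ N₂ Dir.C := rfl
/-- the `D`-coefficients of the subquotient datum [cite: Kovacevic2021, §3 Remark 6] -/
@[simp] theorem subquotient_D : (𝒟.subquotient N₁ N₂).D = 𝒟.sqCoef N₁ N₂ Dir.D := rfl

variable {𝒟 N₁ N₂}

/-- **The gauge-invariant products of the subquotient are those of `𝒟`** on `sqSet`: `A D'`.
[cite: Kovacevic2021, §3 Remark 3] -/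
theorem subquotient_AD {n m : ℤ} (h : (n, m) ∈ 𝒟.sqSet N₁ N₂) :
    (𝒟.subquotient N₁ N₂).A n m * (𝒟.subquotient N₁ N₂).D (n + 1) (m + 3) = 𝒟.A n m * 𝒟.D (n + 1) (m + 3) :=
  sqCoef_mul_sqCoef (δ := Dir.A) (δ' := Dir.D) (n'' := n) (m'' := m) rfl
    (by simp only [Dir.shift, Prod.mk.injEq]; omega) h h

/-- the products `B C'` of the subquotient are those of `𝒟` on `sqSet` [cite: Kovacevic2021, §3 Remark 3] -/
theorem subquotient_BC {n m : ℤ} (h : (n, m) ∈ 𝒟.sqSet N₁ N₂) :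
    (𝒟.subquotient N₁ N₂).B n m * (𝒟.subquotient N₁ N₂).C (n + 1) (m - 3) = 𝒟.B n m * 𝒟.C (n + 1) (m - 3) :=
  sqCoef_mul_sqCoef (δ := Dir.B) (δ' := Dir.C) (n'' := n) (m'' := m) rfl
    (by simp only [Dir.shift, Prod.mk.injEq]; omega) h h

/-- the products `D A''` of the subquotient are those of `𝒟` on `sqSet` [cite: Kovacevic2021, §3 Remark 3] -/
theorem subquotient_DA {n m : ℤ} (h : (n, m) ∈ 𝒟.sqSet N₁ N₂) :
    (𝒟.subquotient N₁ N₂).D n m * (𝒟.subquotient N₁ N₂).A (n - 1) (m - 3) = 𝒟.D n m * 𝒟.A (n - 1) (m - 3) :=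
  sqCoef_mul_sqCoef (δ := Dir.D) (δ' := Dir.A) (n'' := n) (m'' := m) rfl
    (by simp only [Dir.shift, Prod.mk.injEq]; omega) h h

/-- the products `C B''` of the subquotient are those of `𝒟` on `sqSet` [cite: Kovacevic2021, §3 Remark 3] -/
theorem subquotient_CB {n m : ℤ} (h : (n, m) ∈ 𝒟.sqSet N₁ N₂) :
    (𝒟.subquotient N₁ N₂).C n m * (𝒟.subquotient N₁ N₂).B (n - 1) (m + 3) = 𝒟.C n m * 𝒟.B (n - 1) (m + 3) :=
  sqCoef_mul_sqCoef (δ := Dir.C) (δ' := Dir.B) (n'' := n) (m'' := m) rfl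
    (by simp only [Dir.shift, Prod.mk.injEq]; omega) h h

/-- if also the upper end point `(n+1, m+3)` is NOT in `sqSet`, the product `A D'` of the subquotient is `0`
[cite: Kovacevic2021, §3 Remark 6] -/
theorem subquotient_AD_of_not_mem {n m : ℤ} (h : (n, m) ∉ 𝒟.sqSet N₁ N₂) :
    (𝒟.subquotient N₁ N₂).A n m * (𝒟.subquotient N₁ N₂).D (n + 1) (m + 3) = 0 := by
  rw [subquotient_A, sqCoef_of_not_mem_src h, zero_mul]

/-- **The Casimir scalar of the subquotient datum is that of `𝒟`** on its `K`-types (all four products at a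
`K`-type of `sqSet` survive). [cite: Kovacevic2021, §3 Remark 3] [cite: BorelWallach2000, II §2.5] -/
theorem subquotient_casimirScalar {n m : ℤ} (h : (n, m) ∈ 𝒟.sqSet N₁ N₂) :
    (𝒟.subquotient N₁ N₂).casimirScalar n m = 𝒟.casimirScalar n m := by
  rw [casimirScalar, casimirScalar, subquotient_AD h, subquotient_BC h, subquotient_DA h, subquotient_CB h]

/-! ## §3 Live steps and reachability inside the subquotient -/

/-- **A live step of the subquotient datum is a live step of `𝒟` between two `K`-types of `sqSet`.**
[cite: Kovacevic2021, §3 Remark 2, Remark 6] -/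
theorem step_subquotient_iff {δ : Dir} {x y : ℤ × ℤ} :
    (𝒟.subquotient N₁ N₂).Step δ x y ↔ x ∈ 𝒟.sqSet N₁ N₂ ∧ y ∈ 𝒟.sqSet N₁ N₂ ∧ 𝒟.Step δ x y := by
  constructor
  · rintro ⟨hx, hy, hxy, hc⟩
    rw [subquotient_coef] at hc
    obtain ⟨-, -, hc'⟩ := sqCoef_ne_zero_iff.1 hc
    exact ⟨hx, hy, hx.1, hy.1, hxy, hc'⟩
  · rintro ⟨hx, hy, h⟩
    refine ⟨hx, hy, h.tgt_eq, ?_⟩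
    rw [subquotient_coef]
    exact sqCoef_ne_zero_iff.2 ⟨hx, h.tgt_eq ▸ hy, h.coef_ne⟩

/-- a live step of `𝒟` inside `sqSet` is a live step of the subquotient [cite: Kovacevic2021, §3 Remark 6] -/
theorem step_subquotient {δ : Dir} {x y : ℤ × ℤ} (h : 𝒟.Step δ x y) (hx : x ∈ 𝒟.sqSet N₁ N₂)
    (hy : y ∈ 𝒟.sqSet N₁ N₂) : (𝒟.subquotient N₁ N₂).Step δ x y :=
  step_subquotient_iff.2 ⟨hx, hy, h⟩

/-- **Reachability inside `sqSet`**: a live walk of `𝒟` all of whose `K`-types lie in `sqSet` is a live walk of the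
subquotient datum (stated for walks generated by steps inside a set `R ⊆ sqSet` closed under the walk).
[cite: Kovacevic2021, §3 proof of Thm 3 ("walk from one vertex to another")] -/
theorem reach_subquotient_of_forall_step {x y : ℤ × ℤ}
    (h : Relation.ReflTransGen (fun a b => a ∈ 𝒟.sqSet N₁ N₂ ∧ b ∈ 𝒟.sqSet N₁ N₂ ∧ 𝒟.Adj a b) x y) :
    (𝒟.subquotient N₁ N₂).Reach x y := by
  induction h with
  | refl => exact Relation.ReflTransGen.refl
  | tail _ hst ih =>
    obtain ⟨ha, hb, δ, hstep⟩ := hst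
    exact Relation.ReflTransGen.tail ih ⟨δ, step_subquotient hstep ha hb⟩

/-! ## §4 Strong connectivity implies irreducibility (any datum) -/

/-- **A strongly connected datum is irreducible**: if `S ≠ ∅` and any `K`-type is reached from any other along live
arrows, then `𝒟.V` is an irreducible `𝔤𝔩(3,ℂ)`-module (an arrow-closed set of `K`-types meeting `S` is closed
under live walks). Converse: `SU21CohomologicalClassification.forall_reach_of_isIrreducible`.
[cite: Kovacevic2021, §3 Thm 2, Remark 2, Remark 6] -/
theorem isIrreducible_of_forall_reach (hne : 𝒟.S.Nonempty) (hconn : ∀ x ∈ 𝒟.S, ∀ y ∈ 𝒟.S, 𝒟.Reach x y) :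
    LieModule.IsIrreducible ℂ (Matrix (Fin 3) (Fin 3) ℂ) 𝒟.V := by
  refine isIrreducible_iff_closed.2 ⟨hne, fun R hA hB hC hD ⟨p, hpR, hpS⟩ y hy => ?_⟩
  have key : ∀ z, 𝒟.Reach p z → z ∈ R := by
    intro z hz
    induction hz with
    | refl => exact hpR
    | tail _ hst ih =>
      obtain ⟨δ, hs⟩ := hst
      rename_i b c _
      obtain ⟨b₁, b₂⟩ := b
      have htgt := hs.tgt_eq
      have hcS := hs.tgt_mem
      have hc := hs.coef_ne
      cases δ
      · rw [htgt] at hcS ⊢; exact hA b₁ b₂ ih hc hcS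
      · rw [htgt] at hcS ⊢; exact hB b₁ b₂ ih hc hcS
      · rw [htgt] at hcS ⊢; exact hC b₁ b₂ ih hc hcS
      · rw [htgt] at hcS ⊢; exact hD b₁ b₂ ih hc hcS
  exact key y (hconn p hpS y hy)

/-- **Irreducibility = strong connectivity** for a datum with a `K`-type. [cite: Kovacevic2021, §3 Thm 2, Remark 2] -/
theorem isIrreducible_iff_forall_reach :
    LieModule.IsIrreducible ℂ (Matrix (Fin 3) (Fin 3) ℂ) 𝒟.V ↔
      𝒟.S.Nonempty ∧ ∀ x ∈ 𝒟.S, ∀ y ∈ 𝒟.S, 𝒟.Reach x y := by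
  refine ⟨fun h => ⟨(isIrreducible_iff_closed.1 h).1, fun x hx y hy => ?_⟩,
    fun h => isIrreducible_of_forall_reach h.1 h.2⟩
  -- the `K`-types reachable from `x` form an arrow-closed set meeting `S`
  have hclosed := (isIrreducible_iff_closed.1 h).2
  refine hclosed {z | 𝒟.Reach x z} ?_ ?_ ?_ ?_ ⟨x, Relation.ReflTransGen.refl, hx⟩ hy
  · intro n m hR hA hS'
    exact Relation.ReflTransGen.tail hR ⟨Dir.A, mem_of_coef_ne_zero Dir.A hA, hS', rfl, hA⟩
  · intro n m hR hB hS'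
    exact Relation.ReflTransGen.tail hR ⟨Dir.B, mem_of_coef_ne_zero Dir.B hB, hS', rfl, hB⟩
  · intro n m hR hC hS'
    exact Relation.ReflTransGen.tail hR ⟨Dir.C, mem_of_coef_ne_zero Dir.C hC, hS', rfl, hC⟩
  · intro n m hR hD hS'
    exact Relation.ReflTransGen.tail hR ⟨Dir.D, mem_of_coef_ne_zero Dir.D hD, hS', rfl, hD⟩

end SU21Datum

end Literature.RepresentationTheory.Kovacevic2021
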